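import Literature.NumberTheory.EllipticCurves.PadicSigmaOddPrime
import Literature.NumberTheory.EllipticCurves.PadicSigmaVariableChangeProofs
import Literature.NumberTheory.EllipticCurves.PadicFormalLogOrder
import HarnessLib

/-!
# `mazur_tate_sigma_exists_odd` reduced to ONE local statement at `p = 3`: a Mazur–Tate pair for every
# `3`-integral model `y² = x³ + a₂x² + a₄x + a₆` over `ℚ₃` with unit discriminant and unit Hasse
# coefficient (proofs only)

Trunk T-NT-EC (Literature/NumberTheory/EllipticCurves). The named fact
`Literature.NumberTheory.EllipticCurves.mazur_tate_sigma_exists_odd` (`PadicSigmaOddPrime.lean`; Mazur–Tate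
1991 Thm. 3.1 / Mazur–Stein–Tate 2006 Thm. 1.3, existence half) has content beyond the tree's `p ≥ 5`
theorem `mazur_tate_sigma_existsUnique_holds` (Blakestad–Grant 2023) only at `p = 3`
(`mazur_tate_sigma_exists_odd_iff_three`). The tree's `p ≥ 5` proof runs through the universal SHORT
Weierstrass curve (`toShortNF`, `r = -b₂/12`), whose ordinary locus is empty modulo `3`. This file performs,
at `p = 3`, the one step of that proof that does survive — the transport to a normal form — with the normal
form available at `3`: Mathlib's `toCharNeTwoNF` (`u = 1`, `r = 0`, `s = -a₁/2`, `t = -a₃/2`; `2 ∈ ℤ₃ˣ`)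
carries `W ⊗ ℚ₃` to a `3`-integral model `y² = x³ + a₂x² + a₄x + a₆` with the same discriminant and a unit
Hasse coefficient (`norm_coeff_formalOmega_variableChange_eq_one`), and a Mazur–Tate pair transports back
(`exists_isMazurTateSigmaPair_of_variableChange`). Hence
`mazur_tate_sigma_exists_odd_of_exists_charNeTwoNF_three`: the fact follows from the purely local statement
"every `3`-integral `V : y² = x³ + a₂x² + a₄x + a₆` over `ℚ₃` with `‖Δ‖₃ = 1` and `‖c₂‖₃ = 1` (`ω = Σ cₙ zⁿ dz`;
`c₂ = a₂`, the Hasse invariant at `3`) has a Mazur–Tate pair" — proved in `PadicSigmaThreeExistence.lean`;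
and conversely `exists_isMazurTateSigmaPair_toCharNeTwoNF_three`. Also `norm_toCharNeTwoNF_le`.

## Sources

* B. Mazur, W. Stein, J. Tate, Doc. Math. Extra Vol. Coates (2006), Thm. 1.3. [MazurSteinTate2006]
* J. S. Balakrishnan, J. Number Theory 161 (2016), §2 eq. (2.3). [Balakrishnan2016]
* C. Blakestad, D. Grant, J. Number Theory 249 (2023), Thm. 1 ("Let p > 3 be prime"). [BlakestadGrant2023]
* J. H. Silverman, AEC 2nd ed. (2009), III.1, VII.1. [SilvermanAEC2009]

Provenance. Re-homed VERBATIM (declaration bodies unchanged; namespaces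
`Summit.BirchSwinnertonDyer.Rank1Residual.X1.PadicSigmaThree[.Universal]` ↦
`Literature.NumberTheory.EllipticCurves.PadicSigmaThree[.Universal]`, intra-tower imports re-pointed)
from `Summits/BirchSwinnertonDyer/Rank1Residual/X1/PadicSigmaThree*.lean` (cell `b2b-bsdres`, unit x1a,
2026-08-22), so that the discharge `Literature.NumberTheory.EllipticCurves.mazur_tate_sigma_exists_odd_holds`
of the Literature named fact `mazur_tate_sigma_exists_odd` (`PadicSigmaOddPrime.lean`) lives in
`Literature/` (which cannot import `Summits/`; ledger promote event 10878647). The `Summits/…/X1` copies are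
thereby refactor debt (to be re-pointed at these modules by a librarian); nothing here is new mathematics
relative to them. (This part was `X1/PadicSigmaThreeReduction.lean`, unit x1a gen 19; its declarations move from
namespace `Summit.BirchSwinnertonDyer.Rank1Residual.X1` to `Literature.NumberTheory.EllipticCurves`.)

Pure proof file: no definitions, no named facts, no `sorry`; standard axioms.
-/

/-! ## Part `PadicSigmaThreeReduction` (= `Summits/BirchSwinnertonDyer/Rank1Residual/X1/PadicSigmaThreeReduction.lean`, declarations verbatim) -/

noncomputable section

open scoped Classical

open PowerSeries WeierstrassCurve Literature.NumberTheory.EllipticCurves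

set_option autoImplicit false

namespace Literature.NumberTheory.EllipticCurves

/-- **Mathlib's `toCharNeTwoNF` is `p`-integral at every odd `p`** for a `p`-integral equation:
`u = 1`, `r = 0`, `s = -a₁/2`, `t = -a₃/2` with `2 ∈ ℤ_pˣ`. (The `p ≥ 5` file proves this inside
`norm_toShortNF_le`; here it is isolated for `p = 3`.) [cite: SilvermanAEC2009, III.1] -/
theorem norm_toCharNeTwoNF_le {p : ℕ} [Fact p.Prime] (hp : 3 ≤ p) (V : WeierstrassCurve ℚ_[p])
    [V.IsIntegral ℤ_[p]] :
    ‖(V.toCharNeTwoNF.u : ℚ_[p])‖ = 1 ∧ ‖V.toCharNeTwoNF.r‖ ≤ 1 ∧ ‖V.toCharNeTwoNF.s‖ ≤ 1 ∧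
      ‖V.toCharNeTwoNF.t‖ ≤ 1 := by
  obtain ⟨h₁, -, h₃, -, -⟩ := V.coeffs_mem_subring
  have h2 : (⅟(2 : ℚ_[p])) ∈ PadicInt.subring p := by
    have := invOf_natCast_mem_subring (p := p) 2 (by norm_num) (by omega)
    simpa using this
  refine ⟨by rw [toCharNeTwoNF_u, Units.val_one, norm_one],
    by rw [toCharNeTwoNF_r, norm_zero]; exact zero_le_one, ?_, ?_⟩
  · rw [toCharNeTwoNF_s, ← PadicInt.mem_subring_iff]; exact mul_mem h2 (neg_mem h₁)
  · rw [toCharNeTwoNF_t, ← PadicInt.mem_subring_iff]; exact mul_mem h2 (neg_mem h₃)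

/-- **`mazur_tate_sigma_exists_odd` ⇐ a Mazur–Tate pair for every `3`-integral model
`y² = x³ + a₂x² + a₄x + a₆` over `ℚ₃` with unit discriminant and unit Hasse coefficient `c₂`.**
For `W/ℚ` globally minimal with good ordinary reduction at `3`, `V := toCharNeTwoNF • (W ⊗ ℚ₃)` is
such a model (`‖Δ_V‖ = ‖Δ_W‖ = 1` by good reduction, `‖c₂(V)‖ = ‖c₂(W)‖ = 1` by ordinarity and
`norm_coeff_formalOmega_variableChange_eq_one`), a pair of `V` transports back to `W ⊗ ℚ₃`
(`exists_isMazurTateSigmaPair_of_variableChange`), and every odd `p ≥ 5` is the tree's theorem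
(`mazur_tate_sigma_exists_odd_iff_three`). Reduction only — the local statement is NOT proved here.
[cite: MazurSteinTate2006, Thm. 1.3] [cite: Balakrishnan2016, §2 eq. (2.3)]
[cite: SilvermanAEC2009, VII.1 Prop. 1.3] -/
theorem mazur_tate_sigma_exists_odd_of_exists_charNeTwoNF_three
    (hex : ∀ (V : WeierstrassCurve ℚ_[3]) [V.IsIntegral ℤ_[3]] [V.IsCharNeTwoNF],
      ‖V.Δ‖ = 1 → ‖coeff 2 V.formalOmega‖ = 1 →
        ∃ σ : ℚ_[3]⟦X⟧, ∃ c : ℚ_[3], V.IsMazurTateSigmaPair σ c) :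
    mazur_tate_sigma_exists_odd := by
  refine mazur_tate_sigma_exists_odd_iff_three.mpr fun W _ _ _ hgood hord ↦ ?_
  set V₀ := W.baseChange ℚ_[3] with hV₀
  have hn := norm_toCharNeTwoNF_le (p := 3) le_rfl V₀
  haveI := V₀.isIntegral_variableChange V₀.toCharNeTwoNF hn.1 hn.2.1 hn.2.2.1 hn.2.2.2
  have hΔ : ‖(V₀.toCharNeTwoNF • V₀).Δ‖ = 1 := by
    rw [variableChange_Δ, toCharNeTwoNF_u, inv_one, Units.val_one, one_pow, one_mul]
    exact norm_Δ_baseChange_eq_one_of_hasGoodReductionAtPrime W 3 hgood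
  have hc : ‖coeff (3 - 1) V₀.formalOmega‖ = 1 := by
    have h := norm_coeff_formalOmega_eq_one_of_good_ordinary W 3 (by decide) hgood hord 0
    rwa [zero_add, pow_one] at h
  have hc' := V₀.norm_coeff_formalOmega_variableChange_eq_one V₀.toCharNeTwoNF hn.1 hn.2.1
    hn.2.2.1 hn.2.2.2 hc
  exact exists_isMazurTateSigmaPair_of_variableChange hn.1 hn.2.1 hn.2.2.1 hn.2.2.2
    (hex _ hΔ hc')

/-- **And `mazur_tate_sigma_exists_odd` gives the local statement back on the models that arise from global curves**: for
`W/ℚ` globally minimal with good ordinary reduction at `3`, the model `toCharNeTwoNF • (W ⊗ ℚ₃)`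
has a Mazur–Tate pair (transport forward along the inverse change, again `3`-integral with
`u = 1`). Bookkeeping only. [cite: MazurSteinTate2006, Thm. 1.3] -/
theorem exists_isMazurTateSigmaPair_toCharNeTwoNF_three (hMT : mazur_tate_sigma_exists_odd)
    (W : WeierstrassCurve ℚ) [W.IsElliptic] [W.IsGloballyMinimal] [Fact (3 : ℕ).Prime]
    (hgood : W.HasGoodReductionAtPrime 3) (hord : ¬ ((3 : ℕ) : ℤ) ∣ W.frobeniusTrace 3) :
    ∃ σ : ℚ_[3]⟦X⟧, ∃ c : ℚ_[3],
      ((W.baseChange ℚ_[3]).toCharNeTwoNF • W.baseChange ℚ_[3]).IsMazurTateSigmaPair σ c := by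
  set V₀ := W.baseChange ℚ_[3] with hV₀
  set vc := V₀.toCharNeTwoNF with hvc
  have hn := norm_toCharNeTwoNF_le (p := 3) le_rfl V₀
  haveI := V₀.isIntegral_variableChange vc hn.1 hn.2.1 hn.2.2.1 hn.2.2.2
  -- the inverse change `vc⁻¹` is again integral with `u = 1`, and `vc⁻¹ • (vc • V₀) = V₀`
  have hu' : ‖((vc⁻¹).u : ℚ_[3])‖ = 1 := by
    rw [hvc, VariableChange.inv_def]; simp
  have hr' : ‖(vc⁻¹).r‖ ≤ 1 := by
    rw [hvc, VariableChange.inv_def]; simp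
  have hs' : ‖(vc⁻¹).s‖ ≤ 1 := by
    have h := hn.2.2.1
    rw [hvc, VariableChange.inv_def]
    simpa [toCharNeTwoNF_u] using h
  have ht' : ‖(vc⁻¹).t‖ ≤ 1 := by
    have h := hn.2.2.2
    rw [hvc, VariableChange.inv_def]
    simpa [toCharNeTwoNF_u, toCharNeTwoNF_r] using h
  refine exists_isMazurTateSigmaPair_of_variableChange hu' hr' hs' ht' ?_
  rw [← mul_smul, inv_mul_cancel, one_smul]
  exact hMT W 3 (by decide) hgood hord

end Literature.NumberTheory.EllipticCurves

end

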